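import Summits.QuantumFields.YangMills.Theorems.BalabanLadderIRcofSchurFejerAmpChar
import HarnessLib

/-!
# Schur–Fejér splitting — §7 (7c): PRODUCT WINDOWS — `blind_pow`, `prodWindow_exact`, `bicyclic_param`, and the two-factor window `windowOf₂` with its split-window clauses

Ideator `ym-ir-idea-22` g4 · crux `IRcof` (stmt-QuantumFields-26930) · row 47 stub S2ᵛ; source `Cruxes/IRcof/Lines/equipartition_seam_SchurFejerCore.lean`
rev 9 (883e0174032ff038) §7 «non-cyclic kernels: abstract amplitude characters, two commuting generators, product windows», extracted VERBATIM by the custody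
LEAD ym-ir-line-ab-p1 g7 (LEAD LANE PROTOCOL (b); ideator's LAND-ASK #5 22:26:02Z; critic ym-ir-crit-3 g4 «LAND-ASK #5 WORD = GO», with its EFFICIENCY OPTION
taken: only the pieces the forthcoming §8 (general finite central kernel) REUSES are landed now — `…SchurFejerAmpChar` (7a) and `…SchurFejerProductWindow`
(7c + the product-window clauses); the bicyclic-specific 7b ∕ 7d ∕ 7e are HELD (staged in the LEAD's folder) until §8 lands or stalls).  This file: `blind_pow`, `prodWindow_exact` (exactness of a product of windows over a product of cyclic groups), `bicyclic_param`, and `windowOf₂ φ₁ N₁ φ₂ N₂` with `continuous_windowOf₂ ∕ _nonneg ∕ _le_one ∕ _inv ∕ _conj ∕ _one ∕ _posType ∕ _exact`.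
Same namespace `…EquipartitionSeam.SchurFejer` (no wholesale `open` downstream).  Gate-forced only: one-line docstrings where the lint requires them.
HONEST: the located lemma S2ᵛ of one registered line, tools for further sub-classes; walls S3 ∕ S5ᵛ untouched; width 0; YM mass gap (Clay) NOT proved;
`IRcof` 0∕1; R4 = `BalabanLadder.UV` only.
-/

set_option autoImplicit false

noncomputable section

open Finset Complex

namespace Summit.QuantumFields.YangMills.Cruxes.IRcof.EquipartitionSeam.SchurFejer

open scoped ComplexOrder Matrix

section ProductWindow

variable {H : Type} [Group H] [TopologicalSpace H]

omit [TopologicalSpace H] in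
/-- Blindness iterates: `W (k h) = W h` ⇒ `W (k^m h) = W h`. -/
theorem blind_pow {W : H → ℝ} {k : H} (hW : ∀ h, W (k * h) = W h) (m : ℕ) (h : H) :
    W (k ^ m * h) = W h := by
  induction m with
  | zero => rw [pow_zero, one_mul]
  | succ m ih => rw [pow_succ', mul_assoc, hW, ih]

omit [TopologicalSpace H] in
/-- EXACTNESS OF THE PRODUCT WINDOW over `Γ = {k₁^a k₂^b}` (bijectively parametrised by `[N₁]×[N₂]`):
each factor exact over its own generator and blind to the other. -/
theorem prodWindow_exact [DecidableEq H] {k₁ k₂ : H} (hk : Commute k₁ k₂) {W₁ W₂ : H → ℝ} {N₁ N₂ : ℕ}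
    (h₁ : ∀ h, ∑ m ∈ range N₁, W₁ (k₁ ^ m * h) = 1) (h₁b : ∀ h, W₁ (k₂ * h) = W₁ h)
    (h₂ : ∀ h, ∑ m ∈ range N₂, W₂ (k₂ ^ m * h) = 1) (h₂b : ∀ h, W₂ (k₁ * h) = W₂ h)
    (Γ : Set H) (hΓ : Γ = ↑((range N₁ ×ˢ range N₂).image (fun p : ℕ × ℕ => k₁ ^ p.1 * k₂ ^ p.2)))
    (hinj : Set.InjOn (fun p : ℕ × ℕ => k₁ ^ p.1 * k₂ ^ p.2) ↑(range N₁ ×ˢ range N₂)) (h : H) :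
    ∑ᶠ k ∈ Γ, W₁ (k * h) * W₂ (k * h) = 1 := by
  classical
  rw [hΓ, finsum_mem_coe_finset, Finset.sum_image hinj, Finset.sum_product]
  have e1 : ∀ a b : ℕ, W₁ (k₁ ^ a * k₂ ^ b * h) = W₁ (k₁ ^ a * h) := by
    intro a b
    rw [(hk.pow_pow a b).eq, mul_assoc, blind_pow h₁b]
  have e2 : ∀ a b : ℕ, W₂ (k₁ ^ a * k₂ ^ b * h) = W₂ (k₂ ^ b * h) := by
    intro a b
    rw [mul_assoc, blind_pow h₂b]
  simp_rw [e1, e2, ← Finset.mul_sum, h₂, mul_one]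
  exact h₁ h

omit [TopologicalSpace H] in
/-- Two independent commuting generators of finite orders `N₁, N₂` inside a subgroup of cardinality `N₁ N₂`
parametrise it bijectively by `(a,b) ↦ k₁^a k₂^b`, `a < N₁`, `b < N₂`. -/
theorem bicyclic_param [DecidableEq H] {k₁ k₂ : H} {N₁ N₂ : ℕ} (hN₁ : orderOf k₁ = N₁) (hN₂ : orderOf k₂ = N₂)
    (hind : Subgroup.zpowers k₁ ⊓ Subgroup.zpowers k₂ = ⊥) (Γ : Subgroup H) (hfin : (Γ : Set H).Finite)
    (hk₁ : k₁ ∈ Γ) (hk₂ : k₂ ∈ Γ) (hcard : Nat.card Γ = N₁ * N₂) :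
    Set.InjOn (fun p : ℕ × ℕ => k₁ ^ p.1 * k₂ ^ p.2) ↑(range N₁ ×ˢ range N₂) ∧
      (Γ : Set H) = ↑((range N₁ ×ˢ range N₂).image (fun p : ℕ × ℕ => k₁ ^ p.1 * k₂ ^ p.2)) := by
  classical
  have hinj : Set.InjOn (fun p : ℕ × ℕ => k₁ ^ p.1 * k₂ ^ p.2) ↑(range N₁ ×ˢ range N₂) := by
    rintro ⟨a, b⟩ hab ⟨a', b'⟩ hab' e
    simp only [Finset.coe_product, Set.mem_prod, Finset.mem_coe, Finset.mem_range] at hab hab'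
    simp only at e
    -- y := (k₁^a')⁻¹ k₁^a = k₂^b' (k₂^b)⁻¹ lies in both cyclic groups
    have hy : (k₁ ^ a')⁻¹ * k₁ ^ a = k₂ ^ b' * (k₂ ^ b)⁻¹ := by
      rw [inv_mul_eq_iff_eq_mul, ← mul_assoc, eq_mul_inv_iff_mul_eq, e]
    have hy₁ : (k₁ ^ a')⁻¹ * k₁ ^ a ∈ Subgroup.zpowers k₁ :=
      Subgroup.mul_mem _ (Subgroup.inv_mem _ (Subgroup.pow_mem _ (Subgroup.mem_zpowers k₁) _))
        (Subgroup.pow_mem _ (Subgroup.mem_zpowers k₁) _)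
    have hy₂ : (k₁ ^ a')⁻¹ * k₁ ^ a ∈ Subgroup.zpowers k₂ := by
      rw [hy]
      exact Subgroup.mul_mem _ (Subgroup.pow_mem _ (Subgroup.mem_zpowers k₂) _)
        (Subgroup.inv_mem _ (Subgroup.pow_mem _ (Subgroup.mem_zpowers k₂) _))
    have hy1 : (k₁ ^ a')⁻¹ * k₁ ^ a = 1 := by
      rw [← Subgroup.mem_bot, ← hind]
      exact Subgroup.mem_inf.2 ⟨hy₁, hy₂⟩
    have ha : k₁ ^ a' = k₁ ^ a := inv_mul_eq_one.1 hy1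
    have hb : k₂ ^ b' = k₂ ^ b := mul_inv_eq_one.1 (hy ▸ hy1)
    have haa : a = a' := pow_injOn_Iio_orderOf (Set.mem_Iio.2 (hN₁ ▸ hab.1))
      (Set.mem_Iio.2 (hN₁ ▸ hab'.1)) ha.symm
    have hbb : b = b' := pow_injOn_Iio_orderOf (Set.mem_Iio.2 (hN₂ ▸ hab.2))
      (Set.mem_Iio.2 (hN₂ ▸ hab'.2)) hb.symm
    rw [haa, hbb]
  refine ⟨hinj, ?_⟩
  symm
  apply Set.eq_of_subset_of_ncard_le
  · intro y hy
    rw [Finset.coe_image] at hy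
    obtain ⟨⟨a, b⟩, -, rfl⟩ := hy
    exact Γ.mul_mem (Γ.pow_mem hk₁ _) (Γ.pow_mem hk₂ _)
  · rw [← Nat.card_coe_set_eq (Γ : Set H), Set.ncard_coe_finset, Finset.card_image_of_injOn hinj,
      Finset.card_product, Finset.card_range, Finset.card_range]
    exact hcard.le
  · exact hfin

end ProductWindow

section ProductWindowClauses

variable {H : Type} [Group H] [TopologicalSpace H]

/-- The PRODUCT WINDOW of two twist characters (one per generator of a bicyclic kernel). -/
def windowOf₂ (φ₁ : H → ℂ) (N₁ : ℕ) (φ₂ : H → ℂ) (N₂ : ℕ) (h : H) : ℝ :=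
  windowOf φ₁ N₁ h * windowOf φ₂ N₂ h

omit [Group H] in
/-- `continuous_windowOf₂` (see the module docstring; verbatim from the Lines core §7). -/
theorem continuous_windowOf₂ {φ₁ φ₂ : H → ℂ} (h₁ : Continuous φ₁) (h₂ : Continuous φ₂) (N₁ N₂ : ℕ) :
    Continuous (windowOf₂ φ₁ N₁ φ₂ N₂) :=
  (continuous_windowOf h₁ N₁).mul (continuous_windowOf h₂ N₂)

omit [Group H] [TopologicalSpace H] in
/-- `windowOf₂_nonneg` (see the module docstring; verbatim from the Lines core §7). -/
theorem windowOf₂_nonneg {φ₁ φ₂ : H → ℂ} (h₁ : ∀ h, ‖φ₁ h‖ ≤ 1) (h₂ : ∀ h, ‖φ₂ h‖ ≤ 1) (N₁ N₂ : ℕ)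
    (h : H) : 0 ≤ windowOf₂ φ₁ N₁ φ₂ N₂ h :=
  mul_nonneg (windowOf_nonneg h₁ N₁ h) (windowOf_nonneg h₂ N₂ h)

omit [Group H] [TopologicalSpace H] in
/-- `windowOf₂_le_one` (see the module docstring; verbatim from the Lines core §7). -/
theorem windowOf₂_le_one {φ₁ φ₂ : H → ℂ} (h₁ : ∀ h, ‖φ₁ h‖ ≤ 1) (h₂ : ∀ h, ‖φ₂ h‖ ≤ 1) (N₁ N₂ : ℕ)
    (h : H) : windowOf₂ φ₁ N₁ φ₂ N₂ h ≤ 1 :=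
  mul_le_one₀ (windowOf_le_one h₁ N₁ h) (windowOf_nonneg h₂ N₂ h) (windowOf_le_one h₂ N₂ h)

omit [TopologicalSpace H] in
/-- `windowOf₂_inv` (see the module docstring; verbatim from the Lines core §7). -/
theorem windowOf₂_inv {φ₁ φ₂ : H → ℂ} (h₁ : ∀ h, φ₁ h⁻¹ = starRingEnd ℂ (φ₁ h))
    (h₂ : ∀ h, φ₂ h⁻¹ = starRingEnd ℂ (φ₂ h)) (N₁ N₂ : ℕ) (h : H) :
    windowOf₂ φ₁ N₁ φ₂ N₂ h⁻¹ = windowOf₂ φ₁ N₁ φ₂ N₂ h := by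
  unfold windowOf₂
  rw [windowOf_inv h₁, windowOf_inv h₂]

omit [TopologicalSpace H] in
/-- `windowOf₂_conj` (see the module docstring; verbatim from the Lines core §7). -/
theorem windowOf₂_conj {φ₁ φ₂ : H → ℂ} (h₁ : ∀ g h, φ₁ (g * h * g⁻¹) = φ₁ h)
    (h₂ : ∀ g h, φ₂ (g * h * g⁻¹) = φ₂ h) (N₁ N₂ : ℕ) (g h : H) :
    windowOf₂ φ₁ N₁ φ₂ N₂ (g * h * g⁻¹) = windowOf₂ φ₁ N₁ φ₂ N₂ h := by
  unfold windowOf₂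
  rw [windowOf_conj h₁, windowOf_conj h₂]

omit [TopologicalSpace H] in
/-- `windowOf₂_one` (see the module docstring; verbatim from the Lines core §7). -/
theorem windowOf₂_one {φ₁ φ₂ : H → ℂ} (h₁ : φ₁ 1 = 1) (h₂ : φ₂ 1 = 1) {N₁ N₂ : ℕ} (hN₁ : 0 < N₁)
    (hN₂ : 0 < N₂) : windowOf₂ φ₁ N₁ φ₂ N₂ 1 = 1 := by
  unfold windowOf₂
  rw [windowOf_one h₁ hN₁, windowOf_one h₂ hN₂, mul_one]

omit [TopologicalSpace H] in
/-- POSITIVE TYPE of the product window: Schur product of the two PSD Gram matrices. -/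
theorem posSemidef_windowOf₂_gram {φ₁ φ₂ : H → ℂ}
    (hg₁ : ∀ (n : ℕ) (x : Fin n → H), (Matrix.of fun i j : Fin n => φ₁ ((x i)⁻¹ * x j)).PosSemidef)
    (hg₂ : ∀ (n : ℕ) (x : Fin n → H), (Matrix.of fun i j : Fin n => φ₂ ((x i)⁻¹ * x j)).PosSemidef)
    (N₁ N₂ : ℕ) {n : ℕ} (x : Fin n → H) :
    (Matrix.of fun i j : Fin n => ((windowOf₂ φ₁ N₁ φ₂ N₂ ((x i)⁻¹ * x j) : ℝ) : ℂ)).PosSemidef := by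
  have h := (posSemidef_windowOf_gram hg₁ N₁ x).hadamard (posSemidef_windowOf_gram hg₂ N₂ x)
  have heq : (Matrix.of fun i j : Fin n => ((windowOf₂ φ₁ N₁ φ₂ N₂ ((x i)⁻¹ * x j) : ℝ) : ℂ)) =
      (Matrix.of fun i j : Fin n => ((windowOf φ₁ N₁ ((x i)⁻¹ * x j) : ℝ) : ℂ)) ⊙
        (Matrix.of fun i j : Fin n => ((windowOf φ₂ N₂ ((x i)⁻¹ * x j) : ℝ) : ℂ)) := by
    ext i j
    simp only [Matrix.of_apply, Matrix.hadamard_apply, windowOf₂, Complex.ofReal_mul]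
  rw [heq]
  exact h

omit [TopologicalSpace H] in
/-- `windowOf₂_posType` (see the module docstring; verbatim from the Lines core §7). -/
theorem windowOf₂_posType {φ₁ φ₂ : H → ℂ}
    (hg₁ : ∀ (n : ℕ) (x : Fin n → H), (Matrix.of fun i j : Fin n => φ₁ ((x i)⁻¹ * x j)).PosSemidef)
    (hg₂ : ∀ (n : ℕ) (x : Fin n → H), (Matrix.of fun i j : Fin n => φ₂ ((x i)⁻¹ * x j)).PosSemidef)
    (N₁ N₂ : ℕ) (n : ℕ) (x : Fin n → H) (v : Fin n → ℂ) :
    0 ≤ (∑ i, ∑ j, (starRingEnd ℂ) (v i) * v j *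
      ((windowOf₂ φ₁ N₁ φ₂ N₂ ((x i)⁻¹ * x j) : ℝ) : ℂ)).re := by
  have hq := (posSemidef_windowOf₂_gram hg₁ hg₂ N₁ N₂ x).dotProduct_mulVec_nonneg v
  have hexp : (∑ i, ∑ j, (starRingEnd ℂ) (v i) * v j *
      ((windowOf₂ φ₁ N₁ φ₂ N₂ ((x i)⁻¹ * x j) : ℝ) : ℂ)) =
      dotProduct (star v)
        (Matrix.mulVec (Matrix.of fun i j : Fin n =>
          ((windowOf₂ φ₁ N₁ φ₂ N₂ ((x i)⁻¹ * x j) : ℝ) : ℂ)) v) := by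
    simp only [dotProduct, Matrix.mulVec, Matrix.of_apply, Pi.star_apply, Complex.star_def,
      Finset.mul_sum]
    refine Finset.sum_congr rfl fun i _ => Finset.sum_congr rfl fun j _ => ?_
    ring
  rw [hexp]
  exact (Complex.nonneg_iff.1 hq).1

omit [TopologicalSpace H] in
/-- EXACTNESS of the product window over the bicyclic group. -/
theorem windowOf₂_exact [DecidableEq H] {k₁ k₂ : H} (hk : Commute k₁ k₂) {φ₁ φ₂ : H → ℂ} {ω₁ ω₂ : ℂ}
    {N₁ N₂ : ℕ} (hφ₁ : ∀ h, φ₁ (k₁ * h) = ω₁ * φ₁ h) (hφ₁b : ∀ h, φ₁ (k₂ * h) = φ₁ h)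
    (hφ₂ : ∀ h, φ₂ (k₂ * h) = ω₂ * φ₂ h) (hφ₂b : ∀ h, φ₂ (k₁ * h) = φ₂ h) (hN₁pos : 0 < N₁)
    (hω₁ : IsPrimitiveRoot ω₁ N₁) (hN₂pos : 0 < N₂) (hω₂ : IsPrimitiveRoot ω₂ N₂) (Γ : Set H)
    (hΓ : Γ = ↑((range N₁ ×ˢ range N₂).image (fun p : ℕ × ℕ => k₁ ^ p.1 * k₂ ^ p.2)))
    (hinj : Set.InjOn (fun p : ℕ × ℕ => k₁ ^ p.1 * k₂ ^ p.2) ↑(range N₁ ×ˢ range N₂)) (h : H) :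
    ∑ᶠ k ∈ Γ, windowOf₂ φ₁ N₁ φ₂ N₂ (k * h) = 1 :=
  prodWindow_exact hk (windowOf_exact_range hφ₁ hN₁pos hω₁) (fun h => by simp only [windowOf, hφ₁b])
    (windowOf_exact_range hφ₂ hN₂pos hω₂) (fun h => by simp only [windowOf, hφ₂b]) Γ hΓ hinj h

end ProductWindowClauses

end Summit.QuantumFields.YangMills.Cruxes.IRcof.EquipartitionSeam.SchurFejer

end
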